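import Literature.Analysis.Convexity.AnisotropicIsoperimetricBrunnMinkowski
import Literature.Analysis.Convexity.AnisotropicIsoperimetricMollifierBound
import Literature.Analysis.Convexity.AnisotropicIsoperimetricExpansion
import Mathlib.Data.Real.Pointwise
import Mathlib.Analysis.Calculus.ContDiff.RCLike
import HarnessLib

/-!
# The anisotropic isoperimetric inequality, IV: the inequality for a mollified indicator

Topic `Literature/Analysis/Convexity`; fourth file of the series `AnisotropicIsoperimetric*.lean`.
For a compact convex `K ∋ 0` in `ℝⁿ` (`n ≥ 2`), a measurable `G` of finite volume and an even
`C²` probability kernel `ρ` of compact support, the mollified indicator `u = ρ * χ_G` satisfies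

  `n · vol(K)^{1/n} · ∫_0^∞ (vol{u > t}^{1/n})^{n-1} dt ≤ P_K(G)`

(`lintegral_rpow_volume_superlevel_le`), where `P_K(G) = sup {∫_G div η : η ∈ C¹_c(ℝⁿ; K)}`.
Proof: compare the Brunn–Minkowski LOWER bound for `∫ sup_{εK} u(· − z)` (part I, with `εK`
in place of `K`) with the first-order UPPER bound (part III); cancel `∫ u`, divide by `ε` and let
`ε → 0`; finally `∫ h_K(−Du) ≤ P_K(G)` by finite `δ`-nets of `K` (part IIb) and `δ → 0`, using
`∫ ‖Du‖ < ∞`. Letting the kernel concentrate (part V) gives the Wulff inequality.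

All statements on `EuclideanSpace ℝ (Fin n)` with Lebesgue measure; no definition is introduced.

## References
* R. J. Gardner, *The Brunn–Minkowski inequality*, Bull. AMS 39 (2002), §5, (13)–(14).
  [`Gardner2002`]
* I. Fonseca, S. Müller, *A uniqueness proof for the Wulff theorem*, Proc. Roy. Soc. Edinburgh
  119A (1991) 125–136 (the Wulff inequality for sets of finite perimeter). [`FonsecaMuller1991`]
-/

noncomputable section

open Set Filter Function Metric
open _root_.MeasureTheory _root_.MeasureTheory.Measure ContinuousLinearMap
open scoped ENNReal NNReal Topology Convolution InnerProductSpace Pointwise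

namespace Literature.Analysis.Convexity

open Literature.MathematicalPhysics.StatisticalMechanics (fieldDivergence)

variable {n : ℕ}

/-! ### `∫ ‖Du‖ < ∞` for a mollified indicator -/

/-- The derivative of a mollified indicator of a set of finite volume is integrable in norm:
`∫ ‖D(ρ * χ_G)‖ < ∞` (each partial derivative is `(∂_i ρ) * χ_G`, a convolution of integrable
functions). [cite: EvansGariepy2015, §5.2.2 Thm 5.3 (proof, step 1)] -/
theorem lintegral_enorm_fderiv_convolution_indicator_lt_top
    {ρ : EuclideanSpace ℝ (Fin n) → ℝ} (hρ : ContDiff ℝ 1 ρ) (hcρ : HasCompactSupport ρ)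
    {G : Set (EuclideanSpace ℝ (Fin n))} (hG : MeasurableSet G) (hGfin : volume G < ⊤) :
    ∫⁻ x, ‖fderiv ℝ (ρ ⋆[lsmul ℝ ℝ, volume] (G.indicator fun _ => (1 : ℝ))) x‖ₑ < ⊤ := by
  set χ : EuclideanSpace ℝ (Fin n) → ℝ := G.indicator fun _ => (1 : ℝ) with hχ_def
  have hχi : Integrable χ volume :=
    (integrable_indicator_iff hG).2 (integrableOn_const hGfin.ne)
  have hχ0 : ∀ x, 0 ≤ χ x := fun x => Set.indicator_nonneg (fun _ _ => zero_le_one) x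
  set u := ρ ⋆[lsmul ℝ ℝ, volume] χ with hu_def
  -- partial derivatives and their absolute kernels
  set dρ : Fin n → EuclideanSpace ℝ (Fin n) → ℝ :=
    fun i t => fderiv ℝ ρ t (EuclideanSpace.single i 1) with hdρ_def
  have hdρc : ∀ i, Continuous (dρ i) := fun i =>
    (hρ.continuous_fderiv one_ne_zero).clm_apply continuous_const
  have hdρi : ∀ i, Integrable (dρ i) volume := fun i =>
    (hdρc i).integrable_of_hasCompactSupport (hcρ.fderiv_apply (𝕜 := ℝ) _)
  have hadi : ∀ i, Integrable (fun t => |dρ i t|) volume := fun i => (hdρi i).abs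
  -- `|∂_i u| ≤ |∂_i ρ| * χ` pointwise
  have hpt : ∀ i x, ‖fderiv ℝ u x (EuclideanSpace.single i 1)‖ ≤
      ((fun t => |dρ i t|) ⋆[lsmul ℝ ℝ, volume] χ) x := by
    intro i x
    rw [hu_def, fderiv_convolution_apply_eq hρ hcρ hχi.locallyIntegrable, convolution_def,
      convolution_def]
    refine (norm_integral_le_integral_norm _).trans (le_of_eq ?_)
    refine integral_congr_ae (Eventually.of_forall fun t => ?_)
    simp only [lsmul_apply, smul_eq_mul, norm_mul, Real.norm_eq_abs, abs_of_nonneg (hχ0 _),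
      hdρ_def]
  -- `‖Du x‖ ≤ Σ_i |∂_i u(x)|`
  have hnorm : ∀ x, ‖fderiv ℝ u x‖ ≤ ∑ i, ‖fderiv ℝ u x (EuclideanSpace.single i 1)‖ := by
    intro x
    refine ContinuousLinearMap.opNorm_le_bound _ (by positivity) fun w => ?_
    conv_lhs => rw [← (EuclideanSpace.basisFun (Fin n) ℝ).sum_repr w]
    rw [_root_.map_sum]
    refine (norm_sum_le _ _).trans ?_
    rw [Finset.sum_mul]
    refine Finset.sum_le_sum fun i _ => ?_
    rw [map_smul, EuclideanSpace.basisFun_apply, EuclideanSpace.basisFun_repr, norm_smul,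
      mul_comm]
    exact mul_le_mul_of_nonneg_left (by simpa using PiLp.norm_apply_le w i) (norm_nonneg _)
  -- integrate
  have hconv_int : ∀ i, Integrable ((fun t => |dρ i t|) ⋆[lsmul ℝ ℝ, volume] χ) volume :=
    fun i => (hadi i).integrable_convolution _ hχi
  calc ∫⁻ x, ‖fderiv ℝ u x‖ₑ
      ≤ ∫⁻ x, ∑ i, ENNReal.ofReal (((fun t => |dρ i t|) ⋆[lsmul ℝ ℝ, volume] χ) x) := by
        refine lintegral_mono fun x => ?_
        rw [← ofReal_norm]
        refine (ENNReal.ofReal_le_ofReal (hnorm x)).trans ?_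
        rw [ENNReal.ofReal_sum_of_nonneg fun i _ => norm_nonneg _]
        exact Finset.sum_le_sum fun i _ => ENNReal.ofReal_le_ofReal (hpt i x)
    _ = ∑ i, ∫⁻ x, ENNReal.ofReal (((fun t => |dρ i t|) ⋆[lsmul ℝ ℝ, volume] χ) x) :=
        lintegral_finsetSum' _ fun i _ =>
          (hconv_int i).aestronglyMeasurable.aemeasurable.ennreal_ofReal
    _ < ⊤ := by
        refine ENNReal.sum_lt_top.2 fun i _ => ?_
        refine lt_of_le_of_lt (lintegral_mono fun x => ?_) (hconv_int i).2
        exact (ENNReal.ofReal_le_ofReal (le_abs_self _)).trans_eq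
          (Real.enorm_eq_ofReal_abs _).symm

/-! ### `∫ h_K(−Du) ≤ P_K(G)` by finite nets -/

/-- **Mollification does not increase the `K`-variation.** For `K` compact convex with `0 ∈ K`,
`ρ ∈ C¹_c` an even probability kernel and `u = ρ * χ_G` (`vol G < ∞`):
`∫ sup_{z ∈ K} (−Du(x)[z]) dx ≤ P_K(G)` — from the finite-net form (part IIb) by covering `K`
with `δ`-balls, `sup_K ≤ max_F + δ‖Du‖`, and `δ → 0`. [cite: EvansGariepy2015, §5.2.2 Thm 5.3 (ii)] -/
theorem lintegral_sSup_neg_fderiv_le_iSup {K : Set (EuclideanSpace ℝ (Fin n))}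
    (hK : IsCompact K) (hKc : Convex ℝ K) (h0K : (0 : EuclideanSpace ℝ (Fin n)) ∈ K)
    {ρ : EuclideanSpace ℝ (Fin n) → ℝ} (hρ : ContDiff ℝ 1 ρ) (hcρ : HasCompactSupport ρ)
    (hρe : ∀ x, ρ (-x) = ρ x) (hρ0 : ∀ x, 0 ≤ ρ x) (hρ1 : ∫ x, ρ x = 1)
    {G : Set (EuclideanSpace ℝ (Fin n))} (hG : MeasurableSet G) (hGfin : volume G < ⊤) :
    ∫⁻ x, ENNReal.ofReal (sSup ((fun z =>
        -(fderiv ℝ (ρ ⋆[lsmul ℝ ℝ, volume] (G.indicator fun _ => (1 : ℝ))) x z)) '' K)) ≤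
      ⨆ (φ : EuclideanSpace ℝ (Fin n) → EuclideanSpace ℝ (Fin n))
        (_ : ContDiff ℝ 1 φ ∧ HasCompactSupport φ ∧ ∀ x, φ x ∈ K),
        ENNReal.ofReal (∫ x in G, fieldDivergence φ x) := by
  set u := ρ ⋆[lsmul ℝ ℝ, volume] (G.indicator fun _ => (1 : ℝ)) with hu_def
  set P := ⨆ (φ : EuclideanSpace ℝ (Fin n) → EuclideanSpace ℝ (Fin n))
        (_ : ContDiff ℝ 1 φ ∧ HasCompactSupport φ ∧ ∀ x, φ x ∈ K),
        ENNReal.ofReal (∫ x in G, fieldDivergence φ x) with hP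
  set I := ∫⁻ x, ‖fderiv ℝ u x‖ₑ with hI
  have hIfin : I < ⊤ := lintegral_enorm_fderiv_convolution_indicator_lt_top hρ hcρ hG hGfin
  -- for every `δ > 0`: `LHS ≤ P + δ I`
  have hδ : ∀ δ : ℝ, 0 < δ →
      ∫⁻ x, ENNReal.ofReal (sSup ((fun z => -(fderiv ℝ u x z)) '' K)) ≤
        P + ENNReal.ofReal δ * I := by
    intro δ hδ
    obtain ⟨t, htK, htfin, hcover⟩ := finite_cover_balls_of_compact hK hδ
    classical
    set F : Finset (EuclideanSpace ℝ (Fin n)) := insert 0 htfin.toFinset with hF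
    have h0F : (0 : EuclideanSpace ℝ (Fin n)) ∈ F := Finset.mem_insert_self _ _
    have hFK : ∀ z ∈ F, z ∈ K := by
      intro z hz
      rcases Finset.mem_insert.1 hz with rfl | hz
      · exact h0K
      · exact htK (htfin.mem_toFinset.1 hz)
    -- pointwise comparison `sup_K ≤ max_F + δ ‖Du x‖`
    have hpt : ∀ x, sSup ((fun z => -(fderiv ℝ u x z)) '' K) ≤
        (F.sup' ⟨0, h0F⟩ fun z => -(fderiv ℝ u x z)) + δ * ‖fderiv ℝ u x‖ := by
      intro x
      refine csSup_le (⟨_, ⟨0, h0K, rfl⟩⟩ : ((fun z => -(fderiv ℝ u x z)) '' K).Nonempty) ?_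
      rintro _ ⟨z, hz, rfl⟩
      obtain ⟨w, hw, hzw⟩ : ∃ w ∈ t, z ∈ ball w δ := by
        simpa only [mem_iUnion, exists_prop] using hcover hz
      have hwF : w ∈ F := Finset.mem_insert_of_mem (htfin.mem_toFinset.2 hw)
      have h1 : -(fderiv ℝ u x w) ≤ F.sup' ⟨0, h0F⟩ fun z => -(fderiv ℝ u x z) :=
        Finset.le_sup' (fun z => -(fderiv ℝ u x z)) hwF
      have h2 : -(fderiv ℝ u x z) ≤ -(fderiv ℝ u x w) + δ * ‖fderiv ℝ u x‖ := by
        have : fderiv ℝ u x w - fderiv ℝ u x z ≤ δ * ‖fderiv ℝ u x‖ := by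
          rw [← map_sub]
          refine (le_abs_self _).trans ?_
          rw [← Real.norm_eq_abs]
          refine (le_opNorm _ _).trans ?_
          rw [mul_comm]
          refine mul_le_mul_of_nonneg_right ?_ (norm_nonneg _)
          rw [← dist_eq_norm, dist_comm]; exact (mem_ball.1 hzw).le
        linarith
      linarith
    calc ∫⁻ x, ENNReal.ofReal (sSup ((fun z => -(fderiv ℝ u x z)) '' K))
        ≤ ∫⁻ x, (ENNReal.ofReal (F.sup' ⟨0, h0F⟩ fun z => -(fderiv ℝ u x z)) +
            ENNReal.ofReal δ * ‖fderiv ℝ u x‖ₑ) := by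
          refine lintegral_mono fun x => ?_
          refine (ENNReal.ofReal_le_ofReal (hpt x)).trans ?_
          refine ENNReal.ofReal_add_le.trans (add_le_add le_rfl ?_)
          rw [ENNReal.ofReal_mul hδ.le, ofReal_norm]
      _ = (∫⁻ x, ENNReal.ofReal (F.sup' ⟨0, h0F⟩ fun z => -(fderiv ℝ u x z))) +
            ENNReal.ofReal δ * I := by
          rw [lintegral_add_right' _ ?_, lintegral_const_mul' _ _ ENNReal.ofReal_ne_top]
          have hu : ContDiff ℝ 1 u := hcρ.contDiff_convolution_left _ hρ
            ((integrable_indicator_iff hG).2 (integrableOn_const hGfin.ne)).locallyIntegrable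
          exact ((hu.continuous_fderiv one_ne_zero).enorm.measurable.const_mul _).aemeasurable
      _ ≤ P + ENNReal.ofReal δ * I := by
          gcongr
          exact lintegral_finsetSup_neg_fderiv_le_iSup hKc hK.isClosed hFK h0F hρ hcρ hρe hρ0
            hρ1 hG hGfin
  -- let `δ → 0`
  have hlim : Tendsto (fun m : ℕ => P + ENNReal.ofReal ((m + 1 : ℝ)⁻¹) * I) atTop (𝓝 P) := by
    have h1 : Tendsto (fun m : ℕ => ENNReal.ofReal ((m + 1 : ℝ)⁻¹)) atTop (𝓝 0) := by
      rw [← ENNReal.ofReal_zero]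
      exact ENNReal.tendsto_ofReal tendsto_one_div_add_atTop_nhds_zero_nat |>.congr'
        (Eventually.of_forall fun m => by simp [one_div])
    have h2 := ENNReal.Tendsto.mul_const h1 (Or.inr hIfin.ne)
    rw [zero_mul] at h2
    simpa using h2.const_add P
  exact ge_of_tendsto' hlim fun m => hδ _ (by positivity)


/-! ### The inequality for a mollified indicator -/

/-- Scaling the constraint set scales the support-type sup: for a linear functional `A` and
`ε ≥ 0`, `sup_{z ∈ εK} (−A z) = ε · sup_{z ∈ K} (−A z)`. [folklore] -/
private theorem sSup_image_neg_apply_smul_set (A : EuclideanSpace ℝ (Fin n) →L[ℝ] ℝ)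
    {ε : ℝ} (hε : 0 ≤ ε) (K : Set (EuclideanSpace ℝ (Fin n))) :
    sSup ((fun z => -(A z)) '' (ε • K)) = ε * sSup ((fun z => -(A z)) '' K) := by
  have : (fun z => -(A z)) '' (ε • K) = ε • ((fun z => -(A z)) '' K) := by
    ext r
    simp only [Set.mem_image, Set.mem_smul_set, smul_eq_mul]
    constructor
    · rintro ⟨z, ⟨k, hk, rfl⟩, rfl⟩
      exact ⟨-(A k), ⟨k, hk, rfl⟩, by rw [map_smul, smul_eq_mul]; ring⟩
    · rintro ⟨_, ⟨k, hk, rfl⟩, rfl⟩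
      exact ⟨ε • k, ⟨k, hk, rfl⟩, by rw [map_smul, smul_eq_mul]; ring⟩
  rw [this, Real.sSup_smul_of_nonneg hε, smul_eq_mul]

/-- The mollified indicator `u = ρ * χ_G` is continuous, nonnegative, and `∫ u < ∞`
(`vol G < ∞`, `ρ ≥ 0` a `C¹_c` kernel). [folklore] -/
private theorem convolution_indicator_basic {ρ : EuclideanSpace ℝ (Fin n) → ℝ}
    (hρ : ContDiff ℝ 1 ρ) (hcρ : HasCompactSupport ρ) (hρ0 : ∀ x, 0 ≤ ρ x)
    {G : Set (EuclideanSpace ℝ (Fin n))} (hG : MeasurableSet G) (hGfin : volume G < ⊤) :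
    Continuous (ρ ⋆[lsmul ℝ ℝ, volume] (G.indicator fun _ => (1 : ℝ))) ∧
      (∀ x, 0 ≤ (ρ ⋆[lsmul ℝ ℝ, volume] (G.indicator fun _ => (1 : ℝ))) x) ∧
      ∫⁻ x, ENNReal.ofReal ((ρ ⋆[lsmul ℝ ℝ, volume] (G.indicator fun _ => (1 : ℝ))) x) < ⊤ := by
  have hχi : Integrable (G.indicator fun _ => (1 : ℝ)) volume :=
    (integrable_indicator_iff hG).2 (integrableOn_const hGfin.ne)
  refine ⟨hcρ.continuous_convolution_left _ hρ.continuous hχi.locallyIntegrable, fun x => ?_, ?_⟩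
  · rw [convolution_def]
    exact integral_nonneg fun t => by
      simp only [lsmul_apply, smul_eq_mul]
      exact mul_nonneg (hρ0 t) (Set.indicator_nonneg (fun _ _ => zero_le_one) _)
  · have hui : Integrable (ρ ⋆[lsmul ℝ ℝ, volume] (G.indicator fun _ => (1 : ℝ))) volume :=
      (hρ.continuous.integrable_of_hasCompactSupport hcρ).integrable_convolution _ hχi
    refine lt_of_le_of_lt (lintegral_mono fun x => ?_) hui.2
    exact (ENNReal.ofReal_le_ofReal (le_abs_self _)).trans_eq (Real.enorm_eq_ofReal_abs _).symm

/-- **The anisotropic isoperimetric inequality for a mollified indicator.** Let `n ≥ 2`,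
`K ⊆ ℝⁿ` compact convex with `0 ∈ K`, `G` measurable of finite volume, `ρ ∈ C²_c` an even
probability kernel and `u = ρ * χ_G`. Then
`n · vol(K)^{1/n} · ∫_0^∞ (vol{u > t}^{1/n})^{n-1} dt ≤ P_K(G) = sup {∫_G div η : η ∈ C¹_c(ℝⁿ; K)}`.
(Brunn–Minkowski lower bound for `∫ sup_{εK} u(· − z)` against the first-order upper bound,
`ε → 0`, then "mollification does not increase the `K`-variation".)
[cite: Gardner2002, §5 (13)–(14)] -/
theorem lintegral_rpow_volume_superlevel_le (hn : 2 ≤ n) {K : Set (EuclideanSpace ℝ (Fin n))}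
    (hK : IsCompact K) (hKc : Convex ℝ K) (h0K : (0 : EuclideanSpace ℝ (Fin n)) ∈ K)
    {ρ : EuclideanSpace ℝ (Fin n) → ℝ} (hρ : ContDiff ℝ 2 ρ) (hcρ : HasCompactSupport ρ)
    (hρe : ∀ x, ρ (-x) = ρ x) (hρ0 : ∀ x, 0 ≤ ρ x) (hρ1 : ∫ x, ρ x = 1)
    {G : Set (EuclideanSpace ℝ (Fin n))} (hG : MeasurableSet G) (hGfin : volume G < ⊤) :
    (n : ℝ≥0∞) * volume K ^ (n⁻¹ : ℝ) *
        ∫⁻ t in Ioi (0 : ℝ), (volume {x | t <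
          (ρ ⋆[lsmul ℝ ℝ, volume] (G.indicator fun _ => (1 : ℝ))) x} ^ (n⁻¹ : ℝ)) ^ (n - 1) ≤
      ⨆ (φ : EuclideanSpace ℝ (Fin n) → EuclideanSpace ℝ (Fin n))
        (_ : ContDiff ℝ 1 φ ∧ HasCompactSupport φ ∧ ∀ x, φ x ∈ K),
        ENNReal.ofReal (∫ x in G, fieldDivergence φ x) := by
  have hn0 : n ≠ 0 := by omega
  set u := ρ ⋆[lsmul ℝ ℝ, volume] (G.indicator fun _ => (1 : ℝ)) with hu_def
  set P := ⨆ (φ : EuclideanSpace ℝ (Fin n) → EuclideanSpace ℝ (Fin n))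
        (_ : ContDiff ℝ 1 φ ∧ HasCompactSupport φ ∧ ∀ x, φ x ∈ K),
        ENNReal.ofReal (∫ x in G, fieldDivergence φ x) with hP
  set H := ∫⁻ x, ENNReal.ofReal (sSup ((fun z => -(fderiv ℝ u x z)) '' K)) with hH
  set J := ∫⁻ t in Ioi (0 : ℝ), (volume {x | t < u x} ^ (n⁻¹ : ℝ)) ^ (n - 1) with hJ
  have hρ1' : ContDiff ℝ 1 ρ := hρ.of_le one_le_two
  obtain ⟨hu_cont, hu0, hu_fin⟩ := convolution_indicator_basic hρ1' hcρ hρ0 hG hGfin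
  -- a Lipschitz constant for `Dρ`, support radii for `ρ` and `K`
  obtain ⟨L, hL⟩ := ContDiff.lipschitzWith_of_hasCompactSupport (hcρ.fderiv ℝ)
    (hρ.fderiv_right (m := 1) (by norm_num)) one_ne_zero
  obtain ⟨Rρ, hRρ⟩ := hcρ.isCompact.isBounded.subset_closedBall (0 : EuclideanSpace ℝ (Fin n))
  obtain ⟨RK, hRK⟩ := hK.isBounded.subset_closedBall (0 : EuclideanSpace ℝ (Fin n))
  have hRK0 : 0 ≤ RK := by simpa using hRK h0K
  set C₁ : ℝ≥0∞ := ENNReal.ofReal (L * RK ^ 2) * volume G *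
    volume (closedBall (0 : EuclideanSpace ℝ (Fin n)) (Rρ + RK)) with hC₁
  have hC₁fin : C₁ ≠ ⊤ := by
    refine ENNReal.mul_ne_top (ENNReal.mul_ne_top ENNReal.ofReal_ne_top hGfin.ne) ?_
    exact (isCompact_closedBall _ _).measure_lt_top.ne
  -- `H ≤ P`
  have hHP : H ≤ P := lintegral_sSup_neg_fderiv_le_iSup hK hKc h0K hρ1' hcρ hρe hρ0 hρ1 hG hGfin
  -- the two-sided estimate at scale `ε`
  have hε : ∀ ε : ℝ, 0 < ε → ε ≤ 1 →
      (n : ℝ≥0∞) * volume K ^ (n⁻¹ : ℝ) * J ≤ H + ENNReal.ofReal ε * C₁ := by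
    intro ε hε hε1
    have hKε : IsCompact (ε • K) := hK.smul ε
    have hKεne : (ε • K).Nonempty := ⟨ε • 0, Set.smul_mem_smul_set h0K⟩
    have hKεr : ε • K ⊆ closedBall 0 (ε * RK) := by
      rintro _ ⟨k, hk, rfl⟩
      have : ‖k‖ ≤ RK := by simpa using hRK hk
      rw [mem_closedBall, dist_zero_right, norm_smul, Real.norm_of_nonneg hε.le]
      exact mul_le_mul_of_nonneg_left this hε.le
    -- lower bound (part I) and upper bound (part III)
    have h1 := lintegral_add_le_lintegral_supConv hn hKε hKεne hu_cont hu0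
    have h2 := lintegral_supConv_le hρ1' hcρ hL hRρ hG hGfin hKε hKεne (by positivity) hKεr
    -- `vol(εK)^{1/n} = ε vol(K)^{1/n}`
    have hvol : volume (ε • K) ^ (n⁻¹ : ℝ) = ENNReal.ofReal ε * volume K ^ (n⁻¹ : ℝ) := by
      have hinv : (0 : ℝ) ≤ (n⁻¹ : ℝ) := by positivity
      rw [Measure.addHaar_smul, finrank_euclideanSpace_fin, abs_of_nonneg (pow_nonneg hε.le _),
        ENNReal.mul_rpow_of_nonneg _ _ hinv,
        ENNReal.ofReal_rpow_of_nonneg (pow_nonneg hε.le _) hinv,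
        Real.pow_rpow_inv_natCast hε.le hn0]
    -- the sup over `εK` is `ε` times the sup over `K`
    have hsup : ∀ x, sSup ((fun z => -(fderiv ℝ u x z)) '' (ε • K)) =
        ε * sSup ((fun z => -(fderiv ℝ u x z)) '' K) := fun x =>
      sSup_image_neg_apply_smul_set (fderiv ℝ u x) hε.le K
    have hH' : ∫⁻ x, ENNReal.ofReal (sSup ((fun z => -(fderiv ℝ u x z)) '' (ε • K))) =
        ENNReal.ofReal ε * H := by
      rw [hH, ← lintegral_const_mul' _ _ ENNReal.ofReal_ne_top]
      refine lintegral_congr fun x => ?_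
      rw [hsup, ENNReal.ofReal_mul hε.le]
    -- the remainder constant is at most `ε² C₁`
    have hrem : ENNReal.ofReal (L * (ε * RK) ^ 2) * volume G *
        volume (closedBall (0 : EuclideanSpace ℝ (Fin n)) (Rρ + ε * RK)) ≤
        ENNReal.ofReal ε * (ENNReal.ofReal ε * C₁) := by
      rw [hC₁, show L * (ε * RK) ^ 2 = ε * (ε * (L * RK ^ 2)) by ring,
        ENNReal.ofReal_mul hε.le, ENNReal.ofReal_mul hε.le]
      simp only [mul_assoc]
      gcongr
      nlinarith
    -- combine
    have hchain : (∫⁻ x, ENNReal.ofReal (u x)) +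
        ENNReal.ofReal ε * ((n : ℝ≥0∞) * volume K ^ (n⁻¹ : ℝ) * J) ≤
        (∫⁻ x, ENNReal.ofReal (u x)) + ENNReal.ofReal ε * (H + ENNReal.ofReal ε * C₁) := by
      have hlhs : (∫⁻ x, ENNReal.ofReal (u x)) +
          ENNReal.ofReal ε * ((n : ℝ≥0∞) * volume K ^ (n⁻¹ : ℝ) * J) =
          (∫⁻ x, ENNReal.ofReal (u x)) + (n : ℝ≥0∞) * volume (ε • K) ^ (n⁻¹ : ℝ) * J := by
        rw [hvol]; ring
      rw [hlhs]
      refine h1.trans (h2.trans ?_)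
      rw [hH', mul_add, ← add_assoc]
      gcongr
    have hcancel := ENNReal.le_of_add_le_add_left hu_fin.ne hchain
    exact (ENNReal.mul_le_mul_iff_right (by simpa using hε) ENNReal.ofReal_ne_top).1 hcancel
  -- let `ε → 0`
  have hlim : Tendsto (fun m : ℕ => H + ENNReal.ofReal ((m + 1 : ℝ)⁻¹) * C₁) atTop (𝓝 H) := by
    have h1 : Tendsto (fun m : ℕ => ENNReal.ofReal ((m + 1 : ℝ)⁻¹)) atTop (𝓝 0) := by
      rw [← ENNReal.ofReal_zero]
      exact ENNReal.tendsto_ofReal tendsto_one_div_add_atTop_nhds_zero_nat |>.congr'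
        (Eventually.of_forall fun m => by simp [one_div])
    have h2 := ENNReal.Tendsto.mul_const h1 (Or.inr hC₁fin)
    rw [zero_mul] at h2
    simpa using h2.const_add H
  refine (ge_of_tendsto' hlim fun m => hε _ (by positivity) ?_).trans hHP
  rw [inv_le_one_iff₀]; right; exact_mod_cast Nat.le_add_left 1 m
end Literature.Analysis.Convexity

end
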